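import Literature.Geometry.GeometricMeasureTheory.CurrentsRepresentable
import Literature.Geometry.GeometricMeasureTheory.PullbackStokes
import Literature.Analysis.FunctionSpaces.LpRieszRepresentation
import Mathlib.MeasureTheory.Function.SimpleFuncDenseLp
import Mathlib.MeasureTheory.Function.LpSpace.Indicator
import Mathlib.MeasureTheory.Function.AEEqOfIntegral

/-!
# The polar decomposition `T = ‖T‖ ∧ T⃗` of a current of finite mass

Federer 4.1.5: a current `T ∈ 𝒟_m(Ω)` representable by integration is `T = ‖T‖ ∧ T⃗` for a
`‖T‖`-measurable `m`-vectorfield `T⃗` with `‖T⃗‖ = 1` `‖T‖`-almost everywhere (mass norm dual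
to the comass); by the Riesz representation theorem applied to the extension `T̄` of `T` to
`L¹(‖T‖)` (`CurrentsRepresentable.lean`). This file proves it for currents of finite mass:

* `L1Dual.*` — **the dual of `L¹(μ)` for a finite measure**: for `Λ ∈ (L¹(μ))^*`, the signed
  measure `A ↦ Λ(1_A)` and its Radon–Nikodym density `h` are those of the tree's
  `Literature/Analysis/FunctionSpaces/LpRieszRepresentation.lean` (`clmSignedMeasure`,
  `clmSignedMeasure_absolutelyContinuous`, at `q = 1`); this file adds `|h| ≤ ‖Λ‖` a.e.
  (`abs_density_le_ae`) and **`Λ u = ∫ u h dμ` for ALL `u ∈ L¹(μ)`**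
  (`apply_eq_integral_mul_density`, by `Lp.induction`; the tree's
  `exists_integrable_clm_eq_integral_mul` covers bounded `u`);
* `Current.IsRepresentable.polar` — **the polar field `T⃗`**, in coordinates
  `T⃗ = Σ_j h_j b_j^*` for a basis `b` of the (finite-dimensional) space of `m`-covectors, `h_j` the
  density of `u ↦ T̄(u b_j)`; it is strongly measurable, a.e. bounded, locally `‖T‖`-integrable;
* `apply_eq_integral_polar : T(φ) = ∫ ⟨T⃗, φ⟩ d‖T‖` and
  **`eq_vectorCurrent_polar : T = ‖T‖ ∧ T⃗`** (finite-dimensional `E`, `𝐌(T) < ∞`);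
* **`norm_polar_ae_eq_one : ‖T⃗‖ = 1` `‖T‖`-a.e.** (inner product spaces, from
  `‖μ ∧ F‖ = μ ⌞ ‖F‖` of `CurrentsVariationMeasure.lean`), packaged as
  `Current.exists_eq_vectorCurrent_of_mass_ne_top`;
* `extend_eq_integral_polar : T̄ u = ∫ ⟨T⃗, u⟩ d‖T‖` for all `u ∈ L¹(‖T‖)` (uniqueness of the
  extension), **`restrictSet_eq_vectorCurrent_polar : T ⌞ A = (‖T‖ ⌞ A) ∧ T⃗`**, and
  **`variation_restrictSet_eq : ‖T ⌞ A‖ = ‖T‖ ⌞ A`**, `mass_restrictSet_eq : 𝐌(T ⌞ A) = ‖T‖(A)`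
  [Federer1969, 4.1.7] (inner product spaces), sharpening `variation_restrictSet_le` of
  `CurrentsRepresentable.lean`.

## References

* H. Federer, *Geometric Measure Theory*, Springer 1969, 4.1.5, 4.1.7 [Federer1969].
-/

noncomputable section

open scoped Distributions ENNReal NNReal Topology ContDiff
open MeasureTheory TopologicalSpace Set Filter Metric Function

namespace Literature.Geometry.GeometricMeasureTheory

set_option maxSynthPendingDepth 3

/-! ### The dual of `L¹(μ)` for a finite measure -/

namespace L1Dual

open Literature.Analysis.FunctionSpaces

variable {α : Type*} [MeasurableSpace α] {μ : Measure α} [IsFiniteMeasure μ]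
  (Λ : (α →₁[μ] ℝ) →L[ℝ] ℝ)

omit [IsFiniteMeasure μ] in
/-- `‖1_A‖₁ = μ(A)` for the indicator `indLp 1 μ hA` of the tree's `LpRieszRepresentation`.
[folklore] -/
theorem norm_indLp_one [IsFiniteMeasure μ] {A : Set α} (hA : MeasurableSet A) :
    ‖indLp 1 μ hA‖ = μ.real A := by
  rw [norm_indicatorConstLp one_ne_zero ENNReal.one_ne_top, norm_one, one_mul, ENNReal.toReal_one,
    div_one, Real.rpow_one]

/-- `|Λ(1_A)| ≤ ‖Λ‖ μ(A)`. [folklore] -/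
theorem abs_apply_indLp_le {A : Set α} (hA : MeasurableSet A) : |Λ (indLp 1 μ hA)| ≤ ‖Λ‖ * μ.real A := by
  rw [← Real.norm_eq_abs, ← norm_indLp_one hA]
  exact Λ.le_opNorm _

/-- The Radon–Nikodym density of `Λ`: the derivative of the signed measure `A ↦ Λ(1_A)` of the
tree's `LpRieszRepresentation.lean` (`clmSignedMeasure`, `q = 1`). [folklore] -/
def density : α → ℝ := (clmSignedMeasure ENNReal.one_ne_top Λ).rnDeriv μ

/-- The density is measurable. [folklore] -/
theorem measurable_density : Measurable (density Λ) := SignedMeasure.measurable_rnDeriv _ _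

/-- The density is integrable. [folklore] -/
theorem integrable_density : Integrable (density Λ) μ := SignedMeasure.integrable_rnDeriv _ _

/-- `∫_A h dμ = Λ(1_A)` (Radon–Nikodym identity for `clmSignedMeasure`). [folklore] -/
theorem setIntegral_density {A : Set α} (hA : MeasurableSet A) :
    ∫ x in A, density Λ x ∂μ = Λ (indLp 1 μ hA) := by
  unfold density
  set ν := clmSignedMeasure ENNReal.one_ne_top Λ
  have h := (SignedMeasure.absolutelyContinuous_iff_withDensityᵥ_rnDeriv_eq ν μ).1
    (clmSignedMeasure_absolutelyContinuous ENNReal.one_ne_top Λ)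
  have h' : (μ.withDensityᵥ (ν.rnDeriv μ)) A = ν A := by rw [h]
  rw [withDensityᵥ_apply (SignedMeasure.integrable_rnDeriv ν μ) hA,
    clmSignedMeasure_apply ENNReal.one_ne_top Λ hA] at h'
  exact h'

/-- **`|h| ≤ ‖Λ‖` almost everywhere.** [folklore] -/
theorem abs_density_le_ae : ∀ᵐ x ∂μ, |density Λ x| ≤ ‖Λ‖ := by
  have hC : Integrable (fun _ : α => ‖Λ‖) μ := integrable_const _
  have h1 : density Λ ≤ᵐ[μ] fun _ => ‖Λ‖ := by
    refine ae_le_of_forall_setIntegral_le (integrable_density Λ) hC fun s hs _ => ?_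
    rw [setIntegral_density Λ hs, setIntegral_const, smul_eq_mul, mul_comm]
    exact (le_abs_self _).trans (abs_apply_indLp_le Λ hs)
  have h2 : (fun _ => -‖Λ‖) ≤ᵐ[μ] density Λ := by
    refine ae_le_of_forall_setIntegral_le hC.neg (integrable_density Λ) fun s hs _ => ?_
    rw [setIntegral_density Λ hs, integral_neg, setIntegral_const, smul_eq_mul, mul_comm, neg_le]
    exact (neg_le_abs _).trans (abs_apply_indLp_le Λ hs)
  filter_upwards [h1, h2] with x hx1 hx2
  exact abs_le.2 ⟨by simpa using hx2, hx1⟩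

/-- `u h` is integrable for `u ∈ L¹`. [folklore] -/
theorem integrable_mul_density (u : α →₁[μ] ℝ) : Integrable (fun x => u x * density Λ x) μ :=
  (L1.integrable_coeFn u).mul_bdd (measurable_density Λ).aestronglyMeasurable
    ((abs_density_le_ae Λ).mono fun x hx => by rw [Real.norm_eq_abs]; exact hx)

/-- The functional `u ↦ ∫ u h dμ`. [folklore] -/
def densityFun (u : α →₁[μ] ℝ) : ℝ := ∫ x, u x * density Λ x ∂μ

/-- `|∫ u h − ∫ v h| ≤ ‖Λ‖ ‖u − v‖₁`. [folklore] -/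
theorem abs_densityFun_sub_le (u v : α →₁[μ] ℝ) :
    |densityFun Λ u - densityFun Λ v| ≤ ‖Λ‖ * ‖u - v‖ := by
  unfold densityFun
  rw [← integral_sub (integrable_mul_density Λ u) (integrable_mul_density Λ v)]
  have hsub : ∀ᵐ x ∂μ, (u - v) x = u x - v x := Lp.coeFn_sub u v
  calc |∫ x, (u x * density Λ x - v x * density Λ x) ∂μ|
      = |∫ x, (u - v) x * density Λ x ∂μ| := by
        congr 1
        refine integral_congr_ae ?_
        filter_upwards [hsub] with x hx
        rw [hx, sub_mul]
    _ ≤ ∫ x, |(u - v) x * density Λ x| ∂μ := by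
        rw [← Real.norm_eq_abs]; exact norm_integral_le_integral_norm _
    _ ≤ ∫ x, ‖Λ‖ * |(u - v) x| ∂μ := by
        refine integral_mono_ae (integrable_mul_density Λ (u - v)).abs
          ((L1.integrable_coeFn (u - v)).abs.const_mul _) ?_
        filter_upwards [abs_density_le_ae Λ] with x hx
        rw [abs_mul, mul_comm]
        exact mul_le_mul_of_nonneg_right hx (abs_nonneg _)
    _ = ‖Λ‖ * ‖u - v‖ := by
        rw [integral_const_mul, L1.norm_eq_integral_norm]
        rfl

/-- `u ↦ ∫ u h dμ` is continuous on `L¹`. [folklore] -/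
theorem continuous_densityFun : Continuous (densityFun Λ) := by
  refine Metric.continuous_iff.2 fun u ε hε => ⟨ε / (‖Λ‖ + 1), div_pos hε (by positivity),
    fun v hv => ?_⟩
  rw [Real.dist_eq]
  calc |densityFun Λ v - densityFun Λ u| ≤ ‖Λ‖ * ‖v - u‖ := abs_densityFun_sub_le Λ v u
    _ ≤ ‖Λ‖ * (ε / (‖Λ‖ + 1)) := by
        rw [← dist_eq_norm]; exact mul_le_mul_of_nonneg_left hv.le (norm_nonneg _)
    _ < ε := by
        rw [mul_div_assoc']
        rw [div_lt_iff₀ (by positivity)]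
        nlinarith [norm_nonneg Λ]

/-- `∫ (1_A c) h = c Λ(1_A)`. [folklore] -/
theorem densityFun_indicatorConstLp {A : Set α} (hA : MeasurableSet A) (hμA : μ A ≠ ⊤) (c : ℝ) :
    densityFun Λ (indicatorConstLp 1 hA hμA c) = Λ (indicatorConstLp 1 hA hμA c) := by
  have hind : (indicatorConstLp 1 hA hμA c : α →₁[μ] ℝ) = c • indLp 1 μ hA := by
    ext1
    refine indicatorConstLp_coeFn.trans ?_
    refine ((Lp.coeFn_smul c (indLp 1 μ hA)).trans ?_).symm
    filter_upwards [indicatorConstLp_coeFn (p := 1) (hs := hA) (hμs := measure_ne_top μ A)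
      (c := (1 : ℝ))] with x hx
    rw [Pi.smul_apply, hx, smul_eq_mul]
    by_cases hxA : x ∈ A
    · rw [indicator_of_mem hxA, indicator_of_mem hxA, mul_one]
    · rw [indicator_of_notMem hxA, indicator_of_notMem hxA, mul_zero]
  rw [hind, map_smul, smul_eq_mul, ← setIntegral_density Λ hA]
  unfold densityFun
  rw [← integral_const_mul, ← integral_indicator hA]
  refine integral_congr_ae ?_
  filter_upwards [Lp.coeFn_smul c (indLp 1 μ hA), indicatorConstLp_coeFn (p := 1) (hs := hA)
    (hμs := measure_ne_top μ A) (c := (1 : ℝ))] with x hx hx1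
  rw [hx, Pi.smul_apply, hx1, smul_eq_mul]
  by_cases hxA : x ∈ A
  · rw [indicator_of_mem hxA, indicator_of_mem hxA, mul_one]
  · rw [indicator_of_notMem hxA, indicator_of_notMem hxA, mul_zero, zero_mul]

/-- **Riesz representation of `(L¹)^*` for a finite measure, for ALL `u ∈ L¹(μ)`**:
`Λ u = ∫ u h dμ`, where `h` is the Radon–Nikodym density of `A ↦ Λ(1_A)` (`|h| ≤ ‖Λ‖` a.e.);
the tree's `exists_integrable_clm_eq_integral_mul` covers bounded `u`, here extended by
`L¹`-continuity of both sides (`Lp.induction`). [folklore] -/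
theorem apply_eq_integral_mul_density (u : α →₁[μ] ℝ) : Λ u = ∫ x, u x * density Λ x ∂μ := by
  change Λ u = densityFun Λ u
  refine Lp.induction (E := ℝ) (p := 1) (μ := μ) ENNReal.one_ne_top
    (fun u : α →₁[μ] ℝ => Λ u = densityFun Λ u) ?_ ?_ ?_ u
  · intro c s hs hμs
    exact (densityFun_indicatorConstLp Λ hs hμs.ne c).symm
  · intro f g hf hg _ hPf hPg
    rw [map_add, hPf, hPg]
    unfold densityFun
    rw [← integral_add (integrable_mul_density Λ _) (integrable_mul_density Λ _)]
    refine integral_congr_ae ?_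
    filter_upwards [Lp.coeFn_add (hf.toLp f) (hg.toLp g)] with x hx
    rw [hx, Pi.add_apply, add_mul]
  · exact isClosed_eq Λ.continuous (continuous_densityFun Λ)

end L1Dual

/-! ### The polar decomposition `T = ‖T‖ ∧ T⃗` of a representable current of finite mass -/

section Polar

variable {E : Type*} [NormedAddCommGroup E] [NormedSpace ℝ E] [FiniteDimensional ℝ E]
  [MeasurableSpace E] [BorelSpace E] {Ω : Opens E} {m : ℕ}

/-- Almost-everywhere form of finite sums in `Lp`. [folklore] -/
theorem Lp_coeFn_finset_sum {α F : Type*} [MeasurableSpace α] {μ : Measure α} [NormedAddCommGroup F]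
    {ι : Type*} (s : Finset ι) (f : ι → (α →₁[μ] F)) :
    ⇑(∑ j ∈ s, f j) =ᵐ[μ] ∑ j ∈ s, ⇑(f j) := by
  classical
  induction s using Finset.induction_on with
  | empty => simpa using Lp.coeFn_zero F 1 μ
  | insert a s ha ih =>
    rw [Finset.sum_insert ha, Finset.sum_insert ha]
    exact (Lp.coeFn_add _ _).trans (ih.mono fun x hx => by rw [Pi.add_apply, hx, Pi.add_apply])

namespace Current.IsRepresentable

/-- A basis of the (finite-dimensional) space of `m`-covectors. [folklore] -/
def covBasis (E : Type*) [NormedAddCommGroup E] [NormedSpace ℝ E] [FiniteDimensional ℝ E] (m : ℕ) :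
    Module.Basis (Fin (Module.finrank ℝ (Covector E m))) ℝ (Covector E m) :=
  haveI := finiteDimensional_continuousAlternatingMap (K := E) (F := ℝ) (ι := Fin m)
  Module.finBasis ℝ (Covector E m)

/-- The coordinate functionals of `covBasis`, as `m`-vectors (`Multivector E m = (Covector E m)^*`).
[folklore] -/
def covCoord (j : Fin (Module.finrank ℝ (Covector E m))) : Multivector E m :=
  haveI := finiteDimensional_continuousAlternatingMap (K := E) (F := ℝ) (ι := Fin m)
  LinearMap.toContinuousLinearMap ((covBasis E m).coord j)

omit [MeasurableSpace E] [BorelSpace E] in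
/-- `covCoord j ω = (coordinates of ω) j`. [folklore] -/
theorem covCoord_apply (j : Fin (Module.finrank ℝ (Covector E m))) (ζ : Covector E m) :
    covCoord j ζ = (covBasis E m).repr ζ j := rfl

omit [MeasurableSpace E] [BorelSpace E] in
/-- Expansion in the basis: `ω = Σ_j (covCoord j ω) • b_j`. [folklore] -/
theorem sum_covCoord_smul (ζ : Covector E m) :
    ∑ j, covCoord j ζ • covBasis E m j = ζ := by
  simp_rw [covCoord_apply]
  exact (covBasis E m).sum_repr ζ

variable {T : Current Ω m} (hT : T.IsRepresentable) (hfin : T.mass ≠ ⊤)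

/-- The scalar functionals `Λ_j(u) = T̄(u • b_j)` on `L¹(‖T‖)`. [cite: Federer1969, 4.1.5] -/
def coordFunctional (j : Fin (Module.finrank ℝ (Covector E m))) :
    (E →₁[T.variation] ℝ) →L[ℝ] ℝ :=
  hT.extend.comp ((ContinuousLinearMap.toSpanSingleton ℝ (covBasis E m j)).compLpL 1 T.variation)

/-- **The polar `m`-vectorfield `T⃗`** of a representable current of finite mass: in coordinates,
`T⃗(x) = Σ_j h_j(x) b_j^*` where `h_j` is the Radon–Nikodym density of `A ↦ T̄(1_A b_j)`.
[cite: Federer1969, 4.1.5] -/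
def polar : E → Multivector E m :=
  haveI := T.isFiniteMeasure_variation hfin
  fun x => ∑ j, L1Dual.density (hT.coordFunctional j) x • covCoord j

/-- `T⃗` is (strongly) measurable. [folklore] -/
theorem stronglyMeasurable_polar : StronglyMeasurable (hT.polar hfin) := by
  haveI := T.isFiniteMeasure_variation hfin
  set g : Fin (Module.finrank ℝ (Covector E m)) → E → Multivector E m :=
    fun j x => L1Dual.density (hT.coordFunctional j) x • (covCoord j : Multivector E m) with hg
  have hfun : hT.polar hfin = ∑ j, g j := by
    funext x
    simp only [Current.IsRepresentable.polar, hg, Finset.sum_apply]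
  rw [hfun]
  refine Finset.stronglyMeasurable_sum _ fun j _ => ?_
  exact (L1Dual.measurable_density _).stronglyMeasurable.smul_const _

/-- `T⃗` is bounded. [folklore] -/
theorem norm_polar_le_ae :
    ∀ᵐ x ∂T.variation, ‖hT.polar hfin x‖ ≤ ∑ j, ‖hT.coordFunctional j‖ * ‖(covCoord j : Multivector E m)‖ := by
  haveI := T.isFiniteMeasure_variation hfin
  have h := fun j => L1Dual.abs_density_le_ae (hT.coordFunctional j)
  have h' : ∀ᵐ x ∂T.variation, ∀ j, |L1Dual.density (hT.coordFunctional j) x| ≤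
      ‖hT.coordFunctional j‖ := ae_all_iff.2 h
  filter_upwards [h'] with x hx
  refine (norm_sum_le _ _).trans (Finset.sum_le_sum fun j _ => ?_)
  rw [norm_smul, Real.norm_eq_abs]
  exact mul_le_mul_of_nonneg_right (hx j) (norm_nonneg _)

/-- A bounded version of `T⃗` (equal a.e.), convenient for local integrability. We simply truncate:
`T⃗` itself is a.e. bounded, so it is locally integrable. [folklore] -/
theorem locallyIntegrableOn_polar : LocallyIntegrableOn (hT.polar hfin) (Ω : Set E) T.variation := by
  haveI := T.isFiniteMeasure_variation hfin
  refine (Integrable.integrableOn ?_).locallyIntegrableOn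
  refine ⟨(hT.stronglyMeasurable_polar hfin).aestronglyMeasurable, ?_⟩
  exact HasFiniteIntegral.of_bounded (hT.norm_polar_le_ae hfin)

include hT in
/-- The scalar coordinate functions `x ↦ b_j^*(φ x)` of a test form are `‖T‖`-integrable.
[folklore] -/
theorem integrable_covCoord_comp (φ : TestForm Ω m) (j : Fin (Module.finrank ℝ (Covector E m))) :
    Integrable (fun x => covCoord j (φ x)) T.variation :=
  (covCoord j : Multivector E m).integrable_comp (hT.integrable_testForm φ)

/-- **In `L¹(‖T‖)`, `[φ] = Σ_j (b_j^* ∘ φ) • b_j`.** [folklore] -/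
theorem toL1_eq_sum (φ : TestForm Ω m) :
    hT.toL1 φ = ∑ j, (ContinuousLinearMap.toSpanSingleton ℝ (covBasis E m j)).compLpL 1 T.variation
      ((hT.integrable_covCoord_comp φ j).toL1 _) := by
  apply Lp.ext_iff.2
  refine (hT.coeFn_toL1 φ).trans ((Lp_coeFn_finset_sum _ _).trans ?_).symm
  have h : ∀ j, ⇑((ContinuousLinearMap.toSpanSingleton ℝ (covBasis E m j)).compLpL 1 T.variation
      ((hT.integrable_covCoord_comp φ j).toL1 _)) =ᵐ[T.variation]
      fun x => covCoord j (φ x) • covBasis E m j := by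
    intro j
    filter_upwards [ContinuousLinearMap.coeFn_compLpL (p := 1) (μ := T.variation)
      (ContinuousLinearMap.toSpanSingleton ℝ (covBasis E m j))
      ((hT.integrable_covCoord_comp φ j).toL1 _), (hT.integrable_covCoord_comp φ j).coeFn_toL1]
      with x hx hx'
    rw [hx, hx', ContinuousLinearMap.toSpanSingleton_apply]
  have h' : ∀ᵐ x ∂T.variation, ∀ j,
      ((ContinuousLinearMap.toSpanSingleton ℝ (covBasis E m j)).compLpL 1 T.variation
        ((hT.integrable_covCoord_comp φ j).toL1 _)) x = covCoord j (φ x) • covBasis E m j :=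
    ae_all_iff.2 h
  filter_upwards [h'] with x hx
  rw [Finset.sum_apply]
  simp_rw [hx]
  exact sum_covCoord_smul (φ x)

/-- **`T(φ) = Σ_j Λ_j(b_j^* ∘ φ)`.** [folklore] -/
theorem apply_eq_sum_coordFunctional (φ : TestForm Ω m) :
    T φ = ∑ j, hT.coordFunctional j ((hT.integrable_covCoord_comp φ j).toL1 _) := by
  rw [← hT.extend_toL1 φ, hT.toL1_eq_sum φ, map_sum]
  rfl

/-- **The polar decomposition, tested**: `T(φ) = ∫ ⟨T⃗(x), φ(x)⟩ d‖T‖(x)`.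
[cite: Federer1969, 4.1.5] -/
theorem apply_eq_integral_polar (φ : TestForm Ω m) :
    T φ = ∫ x, hT.polar hfin x (φ x) ∂T.variation := by
  haveI := T.isFiniteMeasure_variation hfin
  rw [hT.apply_eq_sum_coordFunctional φ]
  have h1 : ∀ j, hT.coordFunctional j ((hT.integrable_covCoord_comp φ j).toL1 _) =
      ∫ x, covCoord j (φ x) * L1Dual.density (hT.coordFunctional j) x ∂T.variation := by
    intro j
    rw [L1Dual.apply_eq_integral_mul_density]
    refine integral_congr_ae ?_
    filter_upwards [(hT.integrable_covCoord_comp φ j).coeFn_toL1] with x hx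
    rw [hx]
  simp_rw [h1]
  have hpt : ∀ x, hT.polar hfin x (φ x) =
      ∑ j, covCoord j (φ x) * L1Dual.density (hT.coordFunctional j) x := by
    intro x
    simp only [Current.IsRepresentable.polar, FunLike.coe_sum, Finset.sum_apply,
      FunLike.coe_smul, Pi.smul_apply, smul_eq_mul]
    exact Finset.sum_congr rfl fun j _ => mul_comm _ _
  simp_rw [hpt]
  refine (integral_finsetSum _ fun j _ => ?_).symm
  exact (hT.integrable_covCoord_comp φ j).mul_bdd (L1Dual.measurable_density _).aestronglyMeasurable
    ((L1Dual.abs_density_le_ae _).mono fun x hx => by rw [Real.norm_eq_abs]; exact hx)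

/-- **The polar decomposition `T = ‖T‖ ∧ T⃗`** of a representable current of finite mass
[Federer1969, 4.1.5: "T = ‖T‖ ∧ T⃗"; 4.1.7]. [cite: Federer1969, 4.1.5] -/
theorem eq_vectorCurrent_polar : T = vectorCurrent T.variation (hT.polar hfin) := by
  ext φ
  rw [vectorCurrent_apply (hT.locallyIntegrableOn_polar hfin), hT.apply_eq_integral_polar hfin φ]

end Current.IsRepresentable

end Polar

section PolarNorm

variable {V : Type*} [NormedAddCommGroup V] [InnerProductSpace ℝ V] [FiniteDimensional ℝ V]
  [MeasurableSpace V] [BorelSpace V] {Ω : Opens V} {m : ℕ}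

namespace Current.IsRepresentable

variable {T : Current Ω m} (hT : T.IsRepresentable) (hfin : T.mass ≠ ⊤)

/-- **`‖T⃗‖ = 1` for `‖T‖`-almost every point** [Federer1969, 4.1.5]: from `‖‖T‖ ∧ T⃗‖ = ‖T‖ ⌞ ‖T⃗‖`
(`variation_vectorCurrent_eq`) and `‖T‖ ∧ T⃗ = T`. [cite: Federer1969, 4.1.5] -/
theorem norm_polar_ae_eq_one : ∀ᵐ x ∂T.variation, ‖hT.polar hfin x‖ = 1 := by
  haveI := T.isFiniteMeasure_variation hfin
  have hvar : T.variation = (T.variation.withDensity fun x => ‖hT.polar hfin x‖ₑ).restrict Ω := by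
    have h := variation_vectorCurrent_eq (μ := T.variation) (hT.locallyIntegrableOn_polar hfin)
    rwa [← hT.eq_vectorCurrent_polar hfin] at h
  have hrestr : T.variation.restrict (Ω : Set V) = T.variation :=
    Measure.restrict_eq_self_of_ae_mem (by
      rw [ae_iff]; exact T.variation_compl)
  -- `∫⁻_s ‖T⃗‖ₑ = ‖T‖(s)` for every measurable `s`
  have hset : ∀ s, MeasurableSet s →
      ∫⁻ x in s, ‖hT.polar hfin x‖ₑ ∂T.variation = T.variation s := by
    intro s hs
    have h1 : T.variation s =
        (T.variation.withDensity fun x => ‖hT.polar hfin x‖ₑ) (s ∩ (Ω : Set V)) := by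
      conv_lhs => rw [hvar]
      rw [Measure.restrict_apply hs]
    rw [h1, withDensity_apply _ (hs.inter Ω.isOpen.measurableSet), ← Measure.restrict_restrict hs,
      hrestr]
  have hmeas : Measurable fun x => ‖hT.polar hfin x‖ₑ :=
    (hT.stronglyMeasurable_polar hfin).enorm
  have hae : (fun x => ‖hT.polar hfin x‖ₑ) =ᵐ[T.variation] fun _ => (1 : ℝ≥0∞) := by
    refine ae_eq_of_forall_setLIntegral_eq_of_sigmaFinite hmeas measurable_const fun s hs _ => ?_
    rw [hset s hs, setLIntegral_one]
  filter_upwards [hae] with x hx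
  rwa [← ofReal_norm, ENNReal.ofReal_eq_one] at hx

include hT hfin in
/-- **Existence of the polar decomposition** [Federer1969, 4.1.5]: a current representable by
integration and of finite mass is `T = ‖T‖ ∧ ξ` for a measurable `m`-vectorfield `ξ` with
`‖ξ‖ = 1` (the mass norm dual to the comass) `‖T‖`-almost everywhere. [cite: Federer1969, 4.1.5] -/
theorem exists_eq_vectorCurrent :
    ∃ ξ : V → Multivector V m, StronglyMeasurable ξ ∧ (∀ᵐ x ∂T.variation, ‖ξ x‖ = 1) ∧
      LocallyIntegrableOn ξ (Ω : Set V) T.variation ∧ T = vectorCurrent T.variation ξ :=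
  ⟨hT.polar hfin, hT.stronglyMeasurable_polar hfin, hT.norm_polar_ae_eq_one hfin,
    hT.locallyIntegrableOn_polar hfin, hT.eq_vectorCurrent_polar hfin⟩

end Current.IsRepresentable

/-- **Polar decomposition of currents of finite mass** [Federer1969, 4.1.5, 4.1.7]: `𝐌(T) < ∞`
iff `T = ‖T‖ ∧ ξ` with `‖T‖` finite and `‖ξ‖ = 1` a.e.; here the forward direction.
[cite: Federer1969, 4.1.5] -/
theorem Current.exists_eq_vectorCurrent_of_mass_ne_top (T : Current Ω m) (hfin : T.mass ≠ ⊤) :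
    ∃ ξ : V → Multivector V m, StronglyMeasurable ξ ∧ (∀ᵐ x ∂T.variation, ‖ξ x‖ = 1) ∧
      LocallyIntegrableOn ξ (Ω : Set V) T.variation ∧ T = vectorCurrent T.variation ξ :=
  Current.IsRepresentable.exists_eq_vectorCurrent (T.isRepresentable_of_mass_ne_top hfin) hfin

end PolarNorm

/-! ### The extension `T̄` as integration against `T⃗`; restrictions `T ⌞ A = (‖T‖ ⌞ A) ∧ T⃗` -/

section PolarExtend

variable {E : Type*} [NormedAddCommGroup E] [NormedSpace ℝ E] [FiniteDimensional ℝ E]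
  [MeasurableSpace E] [BorelSpace E] {Ω : Opens E} {m : ℕ}

namespace Current.IsRepresentable

variable {T : Current Ω m} (hT : T.IsRepresentable) (hfin : T.mass ≠ ⊤)

/-- A uniform a.e. bound for `T⃗`. [folklore] -/
def polarBound : ℝ := ∑ j, ‖hT.coordFunctional j‖ * ‖(covCoord j : Multivector E m)‖

/-- `‖T⃗‖ ≤ polarBound` a.e. [folklore] -/
theorem norm_polar_le_polarBound_ae : ∀ᵐ x ∂T.variation, ‖hT.polar hfin x‖ ≤ hT.polarBound :=
  hT.norm_polar_le_ae hfin

/-- `0 ≤ polarBound`. [folklore] -/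
theorem polarBound_nonneg : 0 ≤ hT.polarBound :=
  Finset.sum_nonneg fun _ _ => mul_nonneg (norm_nonneg _) (norm_nonneg _)

/-- `x ↦ ⟨T⃗(x), u(x)⟩` is a.e. strongly measurable. [folklore] -/
theorem aestronglyMeasurable_polar_apply {u : E → Covector E m}
    (hu : AEStronglyMeasurable u T.variation) :
    AEStronglyMeasurable (fun x => hT.polar hfin x (u x)) T.variation :=
  (covectorPairing E m).aestronglyMeasurable_comp₂ hu
    (hT.stronglyMeasurable_polar hfin).aestronglyMeasurable

/-- `⟨T⃗, u⟩` is integrable for integrable `u`, with `∫ |⟨T⃗, u⟩| ≤ C ‖u‖₁`. [folklore] -/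
theorem integrable_polar_apply {u : E → Covector E m} (hu : Integrable u T.variation) :
    Integrable (fun x => hT.polar hfin x (u x)) T.variation := by
  refine Integrable.mono' (hu.norm.const_mul hT.polarBound)
    (hT.aestronglyMeasurable_polar_apply hfin hu.aestronglyMeasurable) ?_
  filter_upwards [hT.norm_polar_le_polarBound_ae hfin] with x hx
  rw [Real.norm_eq_abs]
  calc |hT.polar hfin x (u x)| ≤ ‖hT.polar hfin x‖ * ‖u x‖ := by
        rw [← Real.norm_eq_abs]; exact ContinuousLinearMap.le_opNorm _ _
    _ ≤ hT.polarBound * ‖u x‖ := mul_le_mul_of_nonneg_right hx (norm_nonneg _)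

/-- `|∫ ⟨T⃗, u⟩| ≤ C ‖u‖₁`. [folklore] -/
theorem abs_integral_polar_apply_le (u : E →₁[T.variation] Covector E m) :
    |∫ x, hT.polar hfin x (u x) ∂T.variation| ≤ hT.polarBound * ‖u‖ := by
  rw [L1.norm_eq_integral_norm, ← integral_const_mul, ← Real.norm_eq_abs]
  refine (norm_integral_le_integral_norm _).trans (integral_mono_ae
    (hT.integrable_polar_apply hfin (L1.integrable_coeFn u)).norm
    ((L1.integrable_coeFn u).norm.const_mul _) ?_)
  filter_upwards [hT.norm_polar_le_polarBound_ae hfin] with x hx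
  rw [Real.norm_eq_abs]
  calc |hT.polar hfin x (u x)| ≤ ‖hT.polar hfin x‖ * ‖u x‖ := by
        rw [← Real.norm_eq_abs]; exact ContinuousLinearMap.le_opNorm _ _
    _ ≤ hT.polarBound * ‖u x‖ := mul_le_mul_of_nonneg_right hx (norm_nonneg _)

/-- **The functional `u ↦ ∫ ⟨T⃗, u⟩ d‖T‖` on `L¹(‖T‖)`.** [cite: Federer1969, 4.1.5] -/
def polarFunctional : (E →₁[T.variation] Covector E m) →L[ℝ] ℝ :=
  LinearMap.mkContinuous
    { toFun := fun u => ∫ x, hT.polar hfin x (u x) ∂T.variation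
      map_add' := fun u v => by
        rw [← integral_add (hT.integrable_polar_apply hfin (L1.integrable_coeFn u))
          (hT.integrable_polar_apply hfin (L1.integrable_coeFn v))]
        refine integral_congr_ae ?_
        filter_upwards [Lp.coeFn_add u v] with x hx
        rw [hx, Pi.add_apply, map_add]
      map_smul' := fun c u => by
        rw [RingHom.id_apply, smul_eq_mul, ← integral_const_mul]
        refine integral_congr_ae ?_
        filter_upwards [Lp.coeFn_smul c u] with x hx
        rw [hx, Pi.smul_apply, map_smul, smul_eq_mul] }
    hT.polarBound fun u => by
      rw [Real.norm_eq_abs]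
      exact hT.abs_integral_polar_apply_le hfin u

/-- Unfolding of `polarFunctional`. [folklore] -/
theorem polarFunctional_apply (u : E →₁[T.variation] Covector E m) :
    hT.polarFunctional hfin u = ∫ x, hT.polar hfin x (u x) ∂T.variation := rfl

/-- **`T̄ u = ∫ ⟨T⃗, u⟩ d‖T‖` for every `u ∈ L¹(‖T‖)`** (uniqueness of the extension).
[cite: Federer1969, 4.1.5] -/
theorem extend_eq_integral_polar (u : E →₁[T.variation] Covector E m) :
    hT.extend u = ∫ x, hT.polar hfin x (u x) ∂T.variation := by
  have h := hT.eq_extend (hT.polarFunctional hfin) fun φ => by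
    rw [hT.polarFunctional_apply, hT.apply_eq_integral_polar hfin φ]
    refine integral_congr_ae ?_
    filter_upwards [hT.coeFn_toL1 φ] with x hx
    rw [hx]
  rw [← h, hT.polarFunctional_apply]

/-- **`T ⌞ A = (‖T‖ ⌞ A) ∧ T⃗`**: the restriction of a representable current of finite mass to a
measurable set is integration against the polar field over `A`. [cite: Federer1969, 4.1.7] -/
theorem restrictSet_eq_vectorCurrent_polar (A : Set E) (hA : MeasurableSet A) :
    hT.restrictSet A hA = vectorCurrent (T.variation.restrict A) (hT.polar hfin) := by
  ext φ
  have hli : LocallyIntegrableOn (hT.polar hfin) (Ω : Set E) (T.variation.restrict A) :=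
    fun x hx =>
      let ⟨U, hU, hi⟩ := hT.locallyIntegrableOn_polar hfin x hx
      ⟨U, hU, hi.mono_measure Measure.restrict_le_self⟩
  rw [hT.restrictSet_apply A hA φ, hT.extend_eq_integral_polar hfin, vectorCurrent_apply hli,
    ← integral_indicator hA]
  refine integral_congr_ae ?_
  filter_upwards [((hT.integrable_testForm φ).indicator hA).coeFn_toL1] with x hx
  rw [hx]
  by_cases hxA : x ∈ A
  · rw [indicator_of_mem hxA, indicator_of_mem hxA]
  · rw [indicator_of_notMem hxA, indicator_of_notMem hxA, map_zero]

end Current.IsRepresentable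

end PolarExtend

section PolarRestrictNorm

variable {V : Type*} [NormedAddCommGroup V] [InnerProductSpace ℝ V] [FiniteDimensional ℝ V]
  [MeasurableSpace V] [BorelSpace V] {Ω : Opens V} {m : ℕ}

namespace Current.IsRepresentable

variable {T : Current Ω m} (hT : T.IsRepresentable) (hfin : T.mass ≠ ⊤)

include hfin in
/-- **`‖T ⌞ A‖ = ‖T‖ ⌞ A`** for a representable current of finite mass and a measurable `A`
[Federer1969, 4.1.7: "‖T ⌞ A‖ = ‖T‖ ⌞ A"]: from `T ⌞ A = (‖T‖ ⌞ A) ∧ T⃗`, `‖μ ∧ F‖ = μ ⌞ ‖F‖`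
and `‖T⃗‖ = 1` a.e. [cite: Federer1969, 4.1.7] -/
theorem variation_restrictSet_eq (A : Set V) (hA : MeasurableSet A) :
    (hT.restrictSet A hA).variation = T.variation.restrict A := by
  have hli : LocallyIntegrableOn (hT.polar hfin) (Ω : Set V) (T.variation.restrict A) :=
    fun x hx =>
      let ⟨U, hU, hi⟩ := hT.locallyIntegrableOn_polar hfin x hx
      ⟨U, hU, hi.mono_measure Measure.restrict_le_self⟩
  rw [hT.restrictSet_eq_vectorCurrent_polar hfin A hA, variation_vectorCurrent_eq hli]
  -- `(μ ⌞ A).withDensity ‖T⃗‖ₑ = μ ⌞ A` since `‖T⃗‖ = 1` μ-a.e., and `μ` lives on `Ω`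
  have h1 : (T.variation.restrict A).withDensity (fun x => ‖hT.polar hfin x‖ₑ) =
      T.variation.restrict A := by
    rw [withDensity_congr_ae (g := fun _ => (1 : ℝ≥0∞)) ?_]
    · exact withDensity_one
    refine ae_restrict_of_ae ?_
    filter_upwards [hT.norm_polar_ae_eq_one hfin] with x hx
    rw [← ofReal_norm, hx, ENNReal.ofReal_one]
  rw [h1, Measure.restrict_restrict Ω.isOpen.measurableSet]
  refine Measure.restrict_congr_set (inter_ae_eq_right_of_ae_eq_univ ?_)
  rw [ae_eq_univ]
  exact T.variation_compl

include hfin in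
/-- **`𝐌(T ⌞ A) = ‖T‖(A)`.** [cite: Federer1969, 4.1.7] -/
theorem mass_restrictSet_eq (A : Set V) (hA : MeasurableSet A) :
    (hT.restrictSet A hA).mass = T.variation A := by
  rw [← Current.variation_univ, hT.variation_restrictSet_eq hfin A hA, Measure.restrict_apply
    MeasurableSet.univ, univ_inter]

end Current.IsRepresentable

end PolarRestrictNorm

end Literature.Geometry.GeometricMeasureTheory
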